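import Summits.NavierStokesRegularity.FunctionalMining.TopEigChannelIntegralSimple
import Literature.Analysis.Matrix.KyFanMaximumPrinciple
import HarnessLib

/-!
# FunctionalMining — the gap form IS `λ₁ > λ₂`: bridge between the simple-point hypothesis of the
# density files and the dictionary's sorted strain eigenvalues; `U_s = {λ₁ > λ₂}` is open, `λ₁` is
# smooth on it, and COROLLARY 3′ (a) of F1 PART I under `λ₁ > λ₂` everywhere

Search for candidate a priori estimates; no regularity claim. Cell `pub-nsfunc`, prove seat
(gen 23). The files `TopEigSmoothEigenpair*`, `TopEigDensity*`, `TopEigChannelIntegralSimple` state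
"`λ₁(S(v)(x))` is simple" in GAP FORM: `S(x)e = λe`, `|e| = 1`, `wᵀS(x)w ≤ (λ − g)|w|²` on `e^⊥`,
`g > 0`. F1 PART I writes `U_s := {x : λ₁(S(x)) > λ₂(S(x))}` with the dictionary's densities
`torusStrainTopEig = λ₁`, `torusStrainMidEig = λ₂` (`StrainEigen.lean`). By Ky Fan's maximum principle
for `k = 2` (`Literature.Analysis.Matrix.KyFan`, Horn–Johnson Cor. 4.3.39) the two agree:

* `TopEig.eigenvalues₀_one_le_of_gapForm` / `TopEig.gapForm_of_eigenvalues₀_lt` — matrix level;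
* `TopEig.torusStrainMidEig_eq_eig_one` — `λ₂ = ` the second sorted eigenvalue (`card = 3`);
* **`TopEig.topEig_sub_midEig_ge_of_gapForm`** — gap form with gap `g` at `x` ⇒ `λ₁(x) − λ₂(x) ≥ g`;
* **`TopEig.exists_gapForm_of_midEig_lt_topEig`** — `λ₂(x) < λ₁(x)` ⇒ gap form at a unit top
  eigenvector with gap `λ₁(x) − λ₂(x)`;
* `TopEig.isOpen_setOf_midEig_lt_topEig` — `U_s` is open;
  `TopEig.contDiffAt_liftAt_torusStrainTopEig_of_midEig_lt` — `λ₁` is `C^∞` at every point of `U_s`;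
* **`TopEig.heatDissipation_topEigMoment_eq_integral_of_midEig_lt`** — COR. 3′ (a) verbatim: if
  `λ₂ < λ₁` on all of `T³` (`v` smooth, divergence free, `q ≥ 1`) then `T(v)` is the integral of the
  non-negative channel density of `TopEigChannelIntegralSimple`.

[ours; cite: HornJohnson2013, Cor. 4.3.39 (Ky Fan) for the bridge]
-/

noncomputable section

open MeasureTheory Set Filter Topology Matrix Finset
open scoped ContDiff

namespace Summit.NavierStokesRegularity.FunctionalMining

open Literature.Analysis Literature.Analysis.FunctionSpaces Literature.Analysis.FunctionSpaces.Torus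
  Literature.Analysis.FluidPDE SharpClass.DirectorForm Literature.Analysis.Matrix

namespace TopEig

/-! ## 1. Matrix level: gap form versus the second sorted eigenvalue (Ky Fan, `k = 2`) -/

section MatrixLevel

variable {ι : Type*} [Fintype ι] [DecidableEq ι]

/-- **Gap form ⇒ `λ₁↓ = λ` and `λ₂↓ ≤ λ − g`.** For a real symmetric `S` with `Se = λe`, `|e| = 1` and
`wᵀSw ≤ (λ − g)|w|²` on `e^⊥` (`g ≥ 0`): the largest sorted eigenvalue is `λ` and the second is at
most `λ − g` (Ky Fan for an optimal orthonormal pair, Bessel `(h₀·e)² + (h₁·e)² ≤ 1`).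
[cite: HornJohnson2013, Cor. 4.3.39] -/
theorem eigenvalues₀_one_le_of_gapForm {S : Matrix ι ι ℝ} (hS : S.IsHermitian) (hk : 2 ≤ Fintype.card ι)
    {e : ι → ℝ} {lam g : ℝ} (he1 : e ⬝ᵥ e = 1) (hSe : S *ᵥ e = lam • e) (hg : 0 ≤ g)
    (hgap : ∀ w, w ⬝ᵥ e = 0 → w ⬝ᵥ S *ᵥ w ≤ (lam - g) * (w ⬝ᵥ w)) :
    hS.eigenvalues₀ (Fin.castLE hk 0) = lam ∧ hS.eigenvalues₀ (Fin.castLE hk 1) ≤ lam - g := by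
  haveI : Nonempty ι := Fintype.card_pos_iff.1 (by omega)
  have hsymm : S.IsSymm := by
    have h := hS
    rw [Matrix.IsHermitian, Matrix.conjTranspose_eq_transpose_of_trivial] at h
    exact h
  have he1' : e ∈ unitSphere ι := he1
  have hgf := gapForm_of_eigenvector hsymm he1' hSe hgap
  have hquad : quad (flat S) e = lam := by
    rw [quad_flat, hSe, dotProduct_smul, he1, smul_eq_mul, mul_one]
  -- `λ₁↓ = lam`
  have h1 : 1 ≤ Fintype.card ι := by omega
  have htop : hS.eigenvalues₀ (Fin.castLE hk 0) = lam := by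
    have h := lam_eq_eigenvalues₀ (A := flat S) hS (fun i j => flat_apply S i j) h1
    rw [lam_eq_of_gapForm he1' hg hgf hquad] at h
    rw [show Fin.castLE hk 0 = Fin.castLE h1 0 from Fin.ext rfl]
    exact h.symm
  refine ⟨htop, ?_⟩
  -- Ky Fan for `k = 2` at an optimal frame
  obtain ⟨h, horth, -, hsum⟩ := KyFan.exists_frame_sum_rayleigh_eq hS hk
  rw [Fin.sum_univ_two, Fin.sum_univ_two, htop] at hsum
  have hunit : ∀ t, h t ∈ unitSphere ι := fun t => by
    show h t ⬝ᵥ h t = 1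
    rw [horth t t, if_pos rfl]
  have hb0 := hgf (h 0) (hunit 0)
  have hb1 := hgf (h 1) (hunit 1)
  rw [quad_flat] at hb0 hb1
  have hbessel := KyFan.sum_sq_dotProduct_le h horth e
  rw [Fin.sum_univ_two, he1] at hbessel
  nlinarith [hb0, hb1, hbessel, hsum, hg]

/-- **`λ₂↓ < λ₁↓` ⇒ gap form** at a unit top eigenvector, with gap `λ₁↓ − λ₂↓`: there is `e` with
`|e| = 1`, `Se = λ₁↓e` and `wᵀSw ≤ λ₂↓|w|²` on `e^⊥` (Ky Fan for the pair `(e, w/|w|)`).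
[cite: HornJohnson2013, Cor. 4.3.39] -/
theorem gapForm_of_eigenvalues₀_lt {S : Matrix ι ι ℝ} (hS : S.IsHermitian) (hk : 2 ≤ Fintype.card ι) :
    ∃ e : ι → ℝ, e ⬝ᵥ e = 1 ∧ S *ᵥ e = hS.eigenvalues₀ (Fin.castLE hk 0) • e ∧
      ∀ w, w ⬝ᵥ e = 0 → w ⬝ᵥ S *ᵥ w ≤ hS.eigenvalues₀ (Fin.castLE hk 1) * (w ⬝ᵥ w) := by
  have h1 : 1 ≤ Fintype.card ι := by omega
  obtain ⟨h, horth, heig, -⟩ := KyFan.exists_frame_sum_rayleigh_eq hS h1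
  have he1 : h 0 ⬝ᵥ h 0 = 1 := by rw [horth 0 0, if_pos rfl]
  have hSe : S *ᵥ h 0 = hS.eigenvalues₀ (Fin.castLE hk 0) • h 0 := by
    rw [heig 0, show Fin.castLE h1 0 = Fin.castLE hk 0 from Fin.ext rfl]
  refine ⟨h 0, he1, hSe, fun w hw => ?_⟩
  by_cases hw0 : w ⬝ᵥ w = 0
  · have : w = 0 := dotProduct_self_eq_zero.1 hw0
    simp [this]
  have hpos : 0 < w ⬝ᵥ w := lt_of_le_of_ne (dotProduct_self_nonneg' w) (Ne.symm hw0)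
  -- normalise `w` and form the orthonormal pair `(h 0, u)`
  set c : ℝ := Real.sqrt (w ⬝ᵥ w) with hc
  have hcpos : 0 < c := Real.sqrt_pos.mpr hpos
  have hcc : c * c = w ⬝ᵥ w := Real.mul_self_sqrt hpos.le
  set u : ι → ℝ := c⁻¹ • w with hu
  have huu : u ⬝ᵥ u = 1 := by
    rw [hu, smul_dotProduct, dotProduct_smul, smul_eq_mul, smul_eq_mul, ← hcc]
    field_simp
  have hue : u ⬝ᵥ h 0 = 0 := by
    rw [hu, smul_dotProduct, smul_eq_mul, hw, mul_zero]
  have heu : h 0 ⬝ᵥ u = 0 := by rw [dotProduct_comm]; exact hue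
  set f : Fin 2 → ι → ℝ := ![h 0, u] with hf
  have hforth : ∀ t s, f t ⬝ᵥ f s = if t = s then (1 : ℝ) else 0 := by
    intro t s
    fin_cases t <;> fin_cases s <;> simp [hf, he1, huu, hue, heu]
  have hky := KyFan.sum_rayleigh_le_sum_eigenvalues₀ hS hk f hforth
  rw [Fin.sum_univ_two, Fin.sum_univ_two] at hky
  have hf0 : f 0 = h 0 := by simp [hf]
  have hf1 : f 1 = u := by simp [hf]
  rw [hf0, hf1] at hky
  have hray0 : h 0 ⬝ᵥ S *ᵥ h 0 = hS.eigenvalues₀ (Fin.castLE hk 0) := by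
    rw [hSe, dotProduct_smul, he1, smul_eq_mul, mul_one]
  rw [hray0] at hky
  -- `uᵀSu ≤ λ₂↓`, rescale
  have hu_le : u ⬝ᵥ S *ᵥ u ≤ hS.eigenvalues₀ (Fin.castLE hk 1) := by linarith
  have hscale : w ⬝ᵥ S *ᵥ w = (c * c) * (u ⬝ᵥ S *ᵥ u) := by
    rw [hu, mulVec_smul, smul_dotProduct, dotProduct_smul, smul_eq_mul, smul_eq_mul]
    field_simp
  rw [hscale, ← hcc]
  nlinarith [hu_le, hcpos]

end MatrixLevel

/-! ## 2. The dictionary's `λ₂` is the second sorted eigenvalue (`card = 3`) -/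

variable {v : UnitAddTorus (Fin 3) → EuclideanSpace ℝ (Fin 3)}

/-- `2 ≤ card (Fin 3)` (private: the statement exists elsewhere in the tree). [folklore] -/
private theorem two_le_card_fin_three : 2 ≤ Fintype.card (Fin 3) := by simp

/-- **`λ₁ = λ₁↓` and `λ₂ = λ₂↓`**: the dictionary's top / middle strain eigenvalue densities are the first
two sorted eigenvalues of `S(v)(x)` (`torusStrainMidEig := tr − λ₁ − λ₃`). [ours, bookkeeping] -/
theorem torusStrainMidEig_eq_eig_one (v : UnitAddTorus (Fin 3) → EuclideanSpace ℝ (Fin 3))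
    (x : UnitAddTorus (Fin 3)) :
    torusStrainTopEig v x = torusStrainEig v x (Fin.castLE two_le_card_fin_three 0) ∧
      torusStrainMidEig v x = torusStrainEig v x (Fin.castLE two_le_card_fin_three 1) := by
  have hd : Fintype.card (Fin 3) = 3 := Fintype.card_fin 3
  set e := torusStrainEig v x with he
  set f : Fin 3 → ℝ := fun j => e (Fin.cast hd.symm j) with hfdef
  have hf : Antitone f := fun a b hab =>
    torusStrainEig_antitone v x (show Fin.cast hd.symm a ≤ Fin.cast hd.symm b by simpa using hab)
  have hsume : ∑ j, f j = ∑ k', e k' :=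
    Fintype.sum_equiv (finCongr hd.symm) f e (fun j => rfl)
  have htop : torusStrainTopEig v x = f 0 := by
    unfold torusStrainTopEig
    rw [← he, ← (finCongr hd.symm).iSup_comp]
    change (⨆ j, f j) = f 0
    exact iSup_eq_apply_zero_of_antitone (by norm_num) hf
  have hbot : torusStrainBotEig v x = f 2 := by
    unfold torusStrainBotEig
    rw [← he, ← (finCongr hd.symm).iInf_comp]
    change (⨅ j, f j) = f 2
    exact le_antisymm (ciInf_le (Set.finite_range f).bddBelow 2) (le_ciInf fun j => hf (Fin.le_last j))
  have h0 : f 0 = e (Fin.castLE two_le_card_fin_three 0) := by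
    rw [hfdef]
    exact congrArg e (Fin.ext rfl)
  have h1 : f 1 = e (Fin.castLE two_le_card_fin_three 1) := by
    rw [hfdef]
    exact congrArg e (Fin.ext rfl)
  refine ⟨by rw [htop, h0], ?_⟩
  unfold torusStrainMidEig
  rw [← he, ← hsume, Fin.sum_univ_three, htop, hbot, h1]
  ring

/-! ## 3. Gap form ⟺ `λ₂ < λ₁` on the torus; `U_s` is open; `λ₁` is smooth on `U_s` -/

/-- **Gap form at `x` with gap `g` ⇒ `λ₁(x) − λ₂(x) ≥ g`** (and `λ₁(x) = λ`). [ours] -/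
theorem topEig_sub_midEig_ge_of_gapForm {x : UnitAddTorus (Fin 3)} {e : Fin 3 → ℝ} {lam g : ℝ}
    (he1 : e ⬝ᵥ e = 1) (hSe : torusStrainMatrix v x *ᵥ e = lam • e) (hg : 0 ≤ g)
    (hgap : ∀ w, w ⬝ᵥ e = 0 → w ⬝ᵥ torusStrainMatrix v x *ᵥ w ≤ (lam - g) * (w ⬝ᵥ w)) :
    torusStrainTopEig v x = lam ∧ g ≤ torusStrainTopEig v x - torusStrainMidEig v x := by
  obtain ⟨htop, hmid⟩ := torusStrainMidEig_eq_eig_one v x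
  obtain ⟨h0, h1⟩ := eigenvalues₀_one_le_of_gapForm (torusStrainMatrix_isHermitian v x)
    two_le_card_fin_three he1 hSe hg hgap
  have htop' : torusStrainTopEig v x = lam := by rw [htop]; exact h0
  have hmid' : torusStrainMidEig v x ≤ lam - g := by rw [hmid]; exact h1
  exact ⟨htop', by linarith⟩

/-- **`λ₂(x) < λ₁(x)` ⇒ gap form at a unit top eigenvector, gap `λ₁(x) − λ₂(x)`.** [ours] -/
theorem exists_gapForm_of_midEig_lt_topEig {x : UnitAddTorus (Fin 3)}
    (hx : torusStrainMidEig v x < torusStrainTopEig v x) :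
    ∃ e : Fin 3 → ℝ, e ⬝ᵥ e = 1 ∧ torusStrainMatrix v x *ᵥ e = torusStrainTopEig v x • e ∧
      0 < torusStrainTopEig v x - torusStrainMidEig v x ∧
      ∀ w, w ⬝ᵥ e = 0 → w ⬝ᵥ torusStrainMatrix v x *ᵥ w ≤
        (torusStrainTopEig v x - (torusStrainTopEig v x - torusStrainMidEig v x)) * (w ⬝ᵥ w) := by
  obtain ⟨htop, hmid⟩ := torusStrainMidEig_eq_eig_one v x
  obtain ⟨e, he1, hSe, hgap⟩ :=
    gapForm_of_eigenvalues₀_lt (torusStrainMatrix_isHermitian v x) two_le_card_fin_three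
  refine ⟨e, he1, ?_, by linarith, fun w hw => ?_⟩
  · rw [htop]; exact hSe
  · have h := hgap w hw
    rw [sub_sub_cancel, hmid]
    exact h

/-- **`U_s = {λ₂ < λ₁}` IS OPEN.** [ours; folklore — Kato II-§5] -/
theorem isOpen_setOf_midEig_lt_topEig (hv : Torus.IsSmooth v) :
    IsOpen {x : UnitAddTorus (Fin 3) | torusStrainMidEig v x < torusStrainTopEig v x} := by
  rw [isOpen_iff_mem_nhds]
  intro x hx
  obtain ⟨e, he1, hSe, hg, hgap⟩ := exists_gapForm_of_midEig_lt_topEig hx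
  have hev := eventually_nhds_gapForm hv he1 hSe hg hgap
  refine mem_of_superset hev fun y hy => ?_
  obtain ⟨e', he1', hSe', hgap'⟩ := hy
  have hg2 : 0 ≤ (torusStrainTopEig v x - torusStrainMidEig v x) / 2 := by linarith
  obtain ⟨-, hge⟩ := topEig_sub_midEig_ge_of_gapForm he1' hSe' hg2 hgap'
  show torusStrainMidEig v y < torusStrainTopEig v y
  linarith

/-- **`λ₁` IS `C^∞` AT EVERY POINT OF `U_s`** (chart form), with a smooth unit top-eigenvector field
there. [ours; F1 PART I Prop. 3] -/
theorem contDiffAt_liftAt_torusStrainTopEig_of_midEig_lt (hv : Torus.IsSmooth v)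
    {x : UnitAddTorus (Fin 3)} (hx : torusStrainMidEig v x < torusStrainTopEig v x) :
    ContDiffAt ℝ ∞ (liftAt (torusStrainTopEig v) x) 0 := by
  obtain ⟨e, he1, hSe, hg, hgap⟩ := exists_gapForm_of_midEig_lt_topEig hx
  obtain ⟨-, -, -, -, hcd⟩ := exists_smooth_topEigenvector_chart_of_gapForm hv he1 hSe hg hgap
  exact hcd

/-! ## 4. COROLLARY 3′ (a) of F1 PART I under `λ₂ < λ₁` everywhere -/

/-- **COROLLARY 3′ (a), VERBATIM.** For `v` smooth and divergence free on `T³`, `q ≥ 1`, with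
`λ₂(x) < λ₁(x)` at every `x` (`λ₁∘S` simple on all of `T³`):
`T(v) = ∫ [q(q−1)λ₁^{q−2}∑ₖ(∂ₖλ₁)² + qλ₁^{q−1}(Δλ₁ − μ(S;ΔS))]`, every value of the integrand `≥ 0`
(grad-λ channel + rotation/tilt channels), in particular `T(v) ≥ 0`. [ours; F1 PART I Cor. 3′ (a)] -/
theorem heatDissipation_topEigMoment_eq_integral_of_midEig_lt {q : ℝ} (hq : 1 ≤ q)
    (hv : Torus.IsSmooth v) (hdiv : Torus.IsDivFree v)
    (hsimple : ∀ x : UnitAddTorus (Fin 3), torusStrainMidEig v x < torusStrainTopEig v x) :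
    heatDissipation (torusTopEigMoment q) v =
        ∫ x, (q * (q - 1) * torusStrainTopEig v x ^ (q - 2) *
              ∑ k, Torus.partialDeriv k (torusStrainTopEig v) x ^ 2 +
            q * torusStrainTopEig v x ^ (q - 1) * (Torus.laplacian (torusStrainTopEig v) x -
              dirTopEig (StrainL4.strainFlat v x) (StrainL4.strainFlat (Torus.laplacian v) x))) ∧
      (∀ x, 0 ≤ q * (q - 1) * torusStrainTopEig v x ^ (q - 2) *
              ∑ k, Torus.partialDeriv k (torusStrainTopEig v) x ^ 2 +
            q * torusStrainTopEig v x ^ (q - 1) * (Torus.laplacian (torusStrainTopEig v) x -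
              dirTopEig (StrainL4.strainFlat v x) (StrainL4.strainFlat (Torus.laplacian v) x))) ∧
      0 ≤ heatDissipation (torusTopEigMoment q) v := by
  have hgf : ∀ x : UnitAddTorus (Fin 3), ∃ (e : Fin 3 → ℝ) (lam g : ℝ), e ⬝ᵥ e = 1 ∧
      torusStrainMatrix v x *ᵥ e = lam • e ∧ 0 < g ∧
      ∀ w, w ⬝ᵥ e = 0 → w ⬝ᵥ torusStrainMatrix v x *ᵥ w ≤ (lam - g) * (w ⬝ᵥ w) := fun x => by
    obtain ⟨e, he1, hSe, hg, hgap⟩ := exists_gapForm_of_midEig_lt_topEig (hsimple x)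
    exact ⟨e, _, _, he1, hSe, hg, hgap⟩
  refine ⟨heatDissipation_topEigMoment_eq_integral_of_simple hq hv hdiv hgf, fun x => ?_,
    heatDissipation_topEigMoment_nonneg_of_simple hq hv hdiv hgf⟩
  obtain ⟨e, he1, hSe, hg, hgap⟩ := exists_gapForm_of_midEig_lt_topEig (hsimple x)
  exact channelIntegrand_nonneg_of_simple hq hv he1 hSe hg hgap
    (lam_pos_of_gapForm_of_isDivFree hv hdiv he1 hSe hg hgap).2

end TopEig

end Summit.NavierStokesRegularity.FunctionalMining

end
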